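import Summits.ValiantsHypothesis.ValiantsHypothesis.Theses.LiouvilleSarnak
import Summits.ValiantsHypothesis.ValiantsHypothesis.Theorems.LiouvilleSarnakLiouvilleInVNPVerifier
import Literature.Computability.AlgebraicComplexity.ValiantCriterionCounting
import Literature.Computability.AlgebraicComplexity.VNPClosedUnderSum

/-!
# Route `LiouvilleSarnak`, item `LiouvilleInVNP` (stmt-ValiantsHypothesis-14777) — part 2/2:
# the Liouville family is in `VNP` over `ℂ`

`liouvilleInVNP_proof : …Theses.LiouvilleSarnak.LiouvilleInVNP` — the family
`Λ_n = ∑_{e ∈ {0,1}ⁿ} λ(Nat.ofBits e + 1) · ∏_{e_i = 1} X_i` is p-definable over `ℂ` (Bürgisser 2000,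
§2.1–2.3: Valiant's criterion in `#P` form). Proof: `λ(N) = 2·[Ω(N) even] - 1` (`liouville_cast_eq`);
`[Ω(N) even]`, `N = ofBits e + 1`, is the certificate count of the polynomial-time verifier of part 1
(the sorted prime factorisation is the UNIQUE witness; primes are certified by `PRIMES ∈ P`, tree
theorem `PRIMES_mem_P_holds`, through `FactUP.isPrimesUPVerifier_of_mem_UP`), so the even-part
family `E_n = ∑_e [Ω even] X^e` is in `VNP` by Valiant's criterion in counting form
(`isVNPFamily_certCountGen`, `ValiantCriterionCounting.lean`); the all-ones family
`U_n = ∑_e X^e` likewise (trivial verifier); and `Λ_n = 2·E_n - U_n` by the closure of `VNP` under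
linear combinations (`IsVNPFamily.C_mul`, `IsVNPFamily.sub`, `VNPClosedUnderSum.lean`).
HONEST FRAMING: bookkeeping (`Λ ∈ VNP`) for a dormant route whose cruxes are open problems; nothing
here bears on `VP ≠ VNP`, which is NOT proved.
-/

noncomputable section

-- layout Summits/ValiantsHypothesis/ValiantsHypothesis forces the duplicated namespace component
set_option linter.dupNamespace false

namespace Summit.ValiantsHypothesis.ValiantsHypothesis.Theorems.LiouvilleSarnak.LiouvilleVNP

open MvPolynomial
open _root_.Computability Literature.Computability.Complexity Literature.Computability.Complexity.Classes
  Literature.Computability.Complexity.Nondeterministic Literature.Computability.Complexity.Brick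
open Literature.Computability.QuantumComplexity Literature.Computability.QuantumComplexity.FactUP
open Literature.Computability.AlgebraicComplexity

/-- An unambiguous polynomial-time primality verifier exists (`PRIMES ∈ P ⊆ UP`, AKS as proved in
the tree). [folklore] -/
theorem exists_primesUPVerifier :
    ∃ (R : Language Bool) (q : Polynomial ℕ) (wit : ℕ → List Bool), R ∈ P ∧ IsPrimesUPVerifier R q wit :=
  isPrimesUPVerifier_of_mem_UP (P_subset_UP (PRIMES_mem_P_holds : PRIMES ∈ P))

/-- The witness of `N = ofBits e + 1`, `e ∈ {0,1}ⁿ`, has length `≤ witPoly q (n + 1)`. [folklore] -/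
theorem length_factWit_ofBits_le {R : Language Bool} {q : Polynomial ℕ} {wit : ℕ → List Bool}
    (hV : IsPrimesUPVerifier R q wit) {n : ℕ} (e : Fin n → Bool) :
    (factWit wit (Nat.ofBits e + 1)).length ≤ ((witPoly q).comp (Polynomial.X + 1)).eval n := by
  rw [Polynomial.eval_comp, Polynomial.eval_add, Polynomial.eval_X, Polynomial.eval_one]
  refine length_factWit_le (Nat.succ_ne_zero _) ?_ fun p hp =>
    (hV.complete p (Nat.prime_of_mem_primeFactorsList hp)).1
  rw [Nat.size_le]
  have := Nat.ofBits_lt_two_pow e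
  rw [pow_succ]
  omega

/-- **The even-part family is in `VNP`**: `(∑_e [Ω(ofBits e + 1) even] · X^e)_n ∈ VNP` over `ℂ`,
by Valiant's criterion in counting form applied to the verifier of part 1. [folklore] -/
theorem isVNPFamily_evenPart :
    IsVNPFamily (σ := fun n => Fin n) (fun n => ∑ e : Fin n → Bool,
      C (((if Even (ArithmeticFunction.cardFactors (Nat.ofBits e + 1)) then 1 else 0 : ℕ) : ℂ)) *
        ∏ t : Fin n, (if e t then X t else 1)) := by
  obtain ⟨R, q, wit, hR, hV⟩ := exists_primesUPVerifier
  have h := isVNPFamily_certCountGen (k := ℂ) (lioLang_mem_P hR q) ((witPoly q).comp (Polynomial.X + 1))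
  have key : (fun n => ∑ e : Fin n → Bool,
      C ((certCount (fun n => ((witPoly q).comp (Polynomial.X + 1)).eval n) (LioLang R q) n e : ℕ) : ℂ) *
        ∏ t : Fin n, (if e t then X t else 1)) = fun n => ∑ e : Fin n → Bool,
      C (((if Even (ArithmeticFunction.cardFactors (Nat.ofBits e + 1)) then 1 else 0 : ℕ) : ℂ)) *
        ∏ t : Fin n, (if e t then X t else 1) := by
    funext n
    refine Finset.sum_congr rfl fun e _ => ?_
    rw [certCount_lioLang hV e (length_factWit_ofBits_le hV e)]
  rw [key] at h
  exact h

/-- The trivial verifier language: every string is accepted. [folklore] -/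
def AllLang : Language Bool := fun _ => True

/-- Every string is in `AllLang`. [folklore] -/
theorem mem_allLang (w : List Bool) : w ∈ AllLang := trivial

/-- `AllLang ∈ P`. [folklore] -/
theorem allLang_mem_P : AllLang ∈ P :=
  mem_P_of_mem_FP (const_mem_FP [true]) _ fun w => ⟨fun _ => rfl, fun h => absurd (mem_allLang w) h⟩

/-- **The all-ones family is in `VNP`**: `(∑_e X^e)_n ∈ VNP` (certificate count of the trivial
verifier with certificate bound `0` is `1`). [folklore] -/
theorem isVNPFamily_allOnes :
    IsVNPFamily (σ := fun n => Fin n) (fun n => ∑ e : Fin n → Bool,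
      C (((1 : ℕ) : ℂ)) * ∏ t : Fin n, (if e t then X t else 1)) := by
  classical
  have h := isVNPFamily_certCountGen (k := ℂ) allLang_mem_P (0 : Polynomial ℕ)
  have key : (fun n => ∑ e : Fin n → Bool,
      C ((certCount (fun n => (0 : Polynomial ℕ).eval n) AllLang n e : ℕ) : ℂ) *
        ∏ t : Fin n, (if e t then X t else 1)) = fun n => ∑ e : Fin n → Bool,
      C (((1 : ℕ) : ℂ)) * ∏ t : Fin n, (if e t then X t else 1) := by
    funext n
    refine Finset.sum_congr rfl fun e _ => ?_
    have hc : certCount (fun n => (0 : Polynomial ℕ).eval n) AllLang n e = 1 := by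
      unfold certCount
      have h0 : (fun n => (0 : Polynomial ℕ).eval n) n + 1 = 1 := by simp
      rw [h0, Finset.range_one, Finset.sum_singleton]
      simp [mem_allLang]
    rw [hc]
  rw [key] at h
  exact h

/-- `λ(N) = 2·[Ω(N) even] - 1` for `N ≥ 1`, in `ℂ`. [folklore] -/
theorem liouville_cast_eq {N : ℕ} (hN : N ≠ 0) :
    ((ArithmeticFunction.liouville N : ℤ) : ℂ) =
      2 * (((if Even (ArithmeticFunction.cardFactors N) then 1 else 0 : ℕ) : ℂ)) - 1 := by
  rw [ArithmeticFunction.liouville_apply hN]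
  by_cases h : Even (ArithmeticFunction.cardFactors N)
  · rw [if_pos h, h.neg_one_pow]; norm_num
  · rw [if_neg h, (Nat.not_even_iff_odd.mp h).neg_one_pow]; norm_num

/-- **`LiouvilleInVNP`**: the Liouville family `(∑_{e ∈ {0,1}ⁿ} λ(ofBits e + 1) X^e)_n` is in `VNP`
over `ℂ` — Valiant's criterion in `#P` form on the unique prime-factorisation certificate, and
`Λ = 2·E - U`. [folklore] -/
theorem liouvilleInVNP_proof :
    Summit.ValiantsHypothesis.ValiantsHypothesis.Theses.LiouvilleSarnak.LiouvilleInVNP := by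
  unfold Summit.ValiantsHypothesis.ValiantsHypothesis.Theses.LiouvilleSarnak.LiouvilleInVNP
  rw [mem_VNP_mk_iff]
  have h := (IsVNPFamily.C_mul isVNPFamily_evenPart fun _ => (2 : ℂ)).sub isVNPFamily_allOnes
  have key : (fun n => C (2 : ℂ) * (∑ e : Fin n → Bool,
      C (((if Even (ArithmeticFunction.cardFactors (Nat.ofBits e + 1)) then 1 else 0 : ℕ) : ℂ)) *
        ∏ t : Fin n, (if e t then X t else 1)) -
      ∑ e : Fin n → Bool, C (((1 : ℕ) : ℂ)) * ∏ t : Fin n, (if e t then X t else 1)) =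
      fun n => ∑ e : Fin n → Bool, C ((ArithmeticFunction.liouville (Nat.ofBits e + 1) : ℤ) : ℂ) *
        ∏ i : Fin n, (if e i then X i else 1) := by
    funext n
    rw [Finset.mul_sum, ← Finset.sum_sub_distrib]
    refine Finset.sum_congr rfl fun e _ => ?_
    rw [liouville_cast_eq (Nat.succ_ne_zero _), map_sub, map_mul, ← mul_assoc, ← sub_mul, map_natCast,
      map_natCast, Nat.cast_one, map_one]
  rw [key] at h
  exact h

end Summit.ValiantsHypothesis.ValiantsHypothesis.Theorems.LiouvilleSarnak.LiouvilleVNP
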